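import Mathlib
import Summits.PneNP.PneNP.Theorems.Nc03AvoidResidualCoreReductionRankKit

/-!
# Route Nc03AvoidResidualCore, item `ResidualCoreReduction` — the solver, VII: classes `3`, `7`, `8`

Helper file for `stmt-PneNP-20227` (sequel of `…ReductionRankKit`; cell pnp-ideate). Polynomial time
solvers for the linear classes `3` (`XOR₂`), `7` (`XOR₃`) — "the first output whose row depends on
the earlier rows" (`solPS`, a prefix-span search, generic in the row shape) — and `8` (all-equal) —
"an output both of whose pair-rows depend on the other outputs' pair-rows", with the complementary
indicator as output. Correctness via `cert3/7/8_exists`, `cert3/7/8_sound` (`…ReductionLinA`) and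
`inSpan_iff`; polynomial time via `codeFP_inSpan` and context-carrying searches.
-/

set_option linter.dupNamespace false -- `Summit.PneNP.PneNP.…`: summit = sub-problem name (D-0017 single-conjunct layout)

namespace Summit.PneNP.PneNP.Theorems.Nc03Reduction

open Literature.Computability.Complexity CodeFP

variable {N M : ℕ} {α : Type}

/-! ## Searches whose test sees the instance -/

/-- Search-and-indicate with a context-dependent test is polynomial time. -/
theorem codeFP_searchOutCtx {eα : α → List Bool} {cands : PRaw → List α} {test : PRaw × α → Bool}
    {readOff : α → List ℕ} (hc : CodeFP prE (rawE eα) cands) (ht : CodeFP (pairE prE eα) bitE test)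
    (hr : CodeFP eα (rawE natE) readOff) :
    CodeFP prE (rawE bitE)
      (fun pr => searchOut pr.2.1 (((cands pr).find? fun x => test (pr, x)).map readOff)) := by
  have hfind : CodeFP prE (optE eα) (fun pr => (cands pr).find? fun x => test (pr, x)) :=
    (rawFind? (σ := PRaw) (eσ := prE) (p := test) ht).comp ((CodeFP.id prE).pair hc)
  have hmap : CodeFP prE (optE (rawE natE)) (fun pr => ((cands pr).find? fun x => test (pr, x)).map readOff) :=
    ((optMap (σ := Unit) (eσ := unitE) (g := fun q => readOff q.2) (hr.comp (snd _ _))).comp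
      ((const prE ()).pair hfind)).congr fun _ => rfl
  have hk := optCases (σ := PRaw) (eσ := prE) (eα := rawE natE) (eδ := rawE bitE)
    (k := fun pr o => searchOut pr.2.1 o)
    (gnone := fun pr => indic pr.2.1 []) (gsome := fun t => indic t.1.2.1 t.2)
    (codeFP_indic.comp (codeFP_M.pair (const prE ([] : List ℕ))))
    (codeFP_indic.comp ((codeFP_M.comp (fst _ _)).pair (snd _ _)))
    (fun _ => rfl) (fun _ _ => rfl)
  exact (hk.comp ((CodeFP.id prE).pair hmap)).congr fun _ => rfl

/-- The complementary indicator list of length `M` of a list of indices. -/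
def coindic (M : ℕ) (S : List ℕ) : List Bool := (List.range M).map fun i => !decide (i ∈ S)

/-- The complementary indicator has length `M`. -/
@[simp] theorem length_coindic (M : ℕ) (S : List ℕ) : (coindic M S).length = M := by simp [coindic]

/-- Reading the complementary indicator at an output. -/
theorem coindic_at (S : List ℕ) (p : Fin M) : (coindic M S).getD p.val false = !decide (p.val ∈ S) := by
  unfold coindic
  rw [List.getD_eq_getElem?_getD, List.getElem?_map, List.getElem?_range p.isLt]
  rfl

/-- The complementary indicator is polynomial time. -/
theorem codeFP_coindic : CodeFP (pairE unE (rawE natE)) (rawE bitE) (fun p => coindic p.1 p.2) := by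
  have hm : CodeFP (pairE (rawE natE) natE) bitE (fun q => !decide (q.2 ∈ q.1)) :=
    ((mem natE_injective).comp ((snd _ _).pair (fst _ _))).not
  exact ((map hm).comp ((snd _ _).pair (urange.comp (fst _ _)))).congr fun _ => rfl

/-- Output of a search with complementary indicator on a hit. -/
def cosearchOut (M : ℕ) (o : Option (List ℕ)) : List Bool :=
  match o with
  | none => indic M []
  | some S => coindic M S

/-- The complementary search output has length `M`. -/
@[simp] theorem length_cosearchOut (M : ℕ) (o : Option (List ℕ)) : (cosearchOut M o).length = M := by
  unfold cosearchOut; split <;> simp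

/-- Complementary search-and-indicate with a context-dependent test is polynomial time. -/
theorem codeFP_cosearchOutCtx {eα : α → List Bool} {cands : PRaw → List α} {test : PRaw × α → Bool}
    {readOff : α → List ℕ} (hc : CodeFP prE (rawE eα) cands) (ht : CodeFP (pairE prE eα) bitE test)
    (hr : CodeFP eα (rawE natE) readOff) :
    CodeFP prE (rawE bitE)
      (fun pr => cosearchOut pr.2.1 (((cands pr).find? fun x => test (pr, x)).map readOff)) := by
  have hfind : CodeFP prE (optE eα) (fun pr => (cands pr).find? fun x => test (pr, x)) :=
    (rawFind? (σ := PRaw) (eσ := prE) (p := test) ht).comp ((CodeFP.id prE).pair hc)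
  have hmap : CodeFP prE (optE (rawE natE)) (fun pr => ((cands pr).find? fun x => test (pr, x)).map readOff) :=
    ((optMap (σ := Unit) (eσ := unitE) (g := fun q => readOff q.2) (hr.comp (snd _ _))).comp
      ((const prE ()).pair hfind)).congr fun _ => rfl
  have hk := optCases (σ := PRaw) (eσ := prE) (eα := rawE natE) (eδ := rawE bitE)
    (k := fun pr o => cosearchOut pr.2.1 o)
    (gnone := fun pr => indic pr.2.1 []) (gsome := fun t => coindic t.1.2.1 t.2)
    (codeFP_indic.comp (codeFP_M.pair (const prE ([] : List ℕ))))
    (codeFP_coindic.comp ((codeFP_M.comp (fst _ _)).pair (snd _ _)))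
    (fun _ => rfl) (fun _ _ => rfl)
  exact (hk.comp ((CodeFP.id prE).pair hmap)).congr fun _ => rfl

/-! ## Row shapes -/

/-- The role-`0,1` index pair of a triple. -/
def r3 (t : ℕ × ℕ × ℕ) : List ℕ := [t.1, t.2.1]
/-- The role-`1,2` index pair of a triple. -/
def r9 (t : ℕ × ℕ × ℕ) : List ℕ := [t.2.1, t.2.2]
/-- All three indices of a triple. -/
def r7 (t : ℕ × ℕ × ℕ) : List ℕ := [t.1, t.2.1, t.2.2]

/-- `r3` is polynomial time. -/
theorem codeFP_r3 : CodeFP tripE (rawE natE) r3 :=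
  ((rawCons natE).comp ((fst _ _).pair ((rawSingleton natE).comp (snd _ _).fst'))).congr fun _ => rfl
/-- `r9` is polynomial time. -/
theorem codeFP_r9 : CodeFP tripE (rawE natE) r9 :=
  ((rawCons natE).comp ((snd _ _).fst'.pair ((rawSingleton natE).comp (snd _ _).snd'))).congr fun _ => rfl
/-- `r7` is polynomial time. -/
theorem codeFP_r7 : CodeFP tripE (rawE natE) r7 :=
  ((rawCons natE).comp ((fst _ _).pair ((rawCons natE).comp ((snd _ _).fst'.pair
    ((rawSingleton natE).comp (snd _ _).snd'))))).congr fun _ => rfl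

/-- `r3` of a genuine triple is `row3`. -/
theorem vecL_r3 (J : LocalMap 3 N M) (j : Fin M) : vecL N (r3 (tripOf J j)) = row3 J j := vecL_pair _ _
/-- `r7` of a genuine triple is `row7`. -/
theorem vecL_r7 (J : LocalMap 3 N M) (j : Fin M) : vecL N (r7 (tripOf J j)) = row7 J j := vecL_trip _ _ _
/-- `r9` of a genuine triple is `row9`. -/
theorem vecL_r9 (J : LocalMap 3 N M) (j : Fin M) : vecL N (r9 (tripOf J j)) = row9 J j := vecL_pair _ _

/-! ## Prefix-span search (classes 3 and 7) -/

/-- Test: the row of the candidate output depends on the rows of the earlier outputs. -/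
def testPS (r : ℕ × ℕ × ℕ → List ℕ) (q : PRaw × ETrip) : Bool :=
  inSpan q.1.1 ((q.1.2.2.take q.2.1).map r) (r q.2.2)

/-- Solver: switch on the first output whose row depends on the earlier rows. -/
def solPS (r : ℕ × ℕ × ℕ → List ℕ) (pr : PRaw) : List Bool :=
  searchOut pr.2.1 (((enumT pr).find? fun x => testPS r (pr, x)).map fun x => [x.1])

/-- Output length of the prefix-span solver. -/
@[simp] theorem length_solPS (r : ℕ × ℕ × ℕ → List ℕ) (pr : PRaw) : (solPS r pr).length = pr.2.1 := by
  unfold solPS; simp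

/-- Membership in a prefix of a tabulated list. -/
theorem mem_take_ofFn {β : Type} {f : Fin M → β} {k : ℕ} {t : β} :
    t ∈ (List.ofFn f).take k ↔ ∃ j : Fin M, j.val < k ∧ f j = t := by
  rw [List.mem_iff_getElem]
  constructor
  · rintro ⟨i, hi, rfl⟩
    rw [List.length_take, List.length_ofFn, lt_min_iff] at hi
    exact ⟨⟨i, hi.2⟩, hi.1, by rw [List.getElem_take, List.getElem_ofFn]⟩
  · rintro ⟨j, hj, rfl⟩
    refine ⟨j.val, by rw [List.length_take, List.length_ofFn, lt_min_iff]; exact ⟨hj, j.isLt⟩, ?_⟩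
    rw [List.getElem_take, List.getElem_ofFn]

/-- The rows of the first `k` outputs, as vectors. -/
theorem vecL_image_take (J : LocalMap 3 N M) (r : ℕ × ℕ × ℕ → List ℕ) (row : Fin M → Vec N)
    (hrow : ∀ j, vecL N (r (tripOf J j)) = row j) (k : ℕ) :
    vecL N '' {x | x ∈ ((List.ofFn (tripOf J)).take k).map r} = row '' {j : Fin M | j.val < k} := by
  ext v
  simp only [Set.mem_image, Set.mem_setOf_eq, List.mem_map, mem_take_ofFn]
  constructor
  · rintro ⟨x, ⟨t, ⟨j, hj, rfl⟩, rfl⟩, rfl⟩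
    exact ⟨j, hj, (hrow j).symm⟩
  · rintro ⟨j, hj, rfl⟩
    exact ⟨r (tripOf J j), ⟨tripOf J j, ⟨j, hj, rfl⟩, rfl⟩, hrow j⟩

/-- Reading the prefix-span test on a genuine instance. -/
theorem testPS_iff (J : LocalMap 3 N M) (r : ℕ × ℕ × ℕ → List ℕ) (row : Fin M → Vec N)
    (hrow : ∀ j, vecL N (r (tripOf J j)) = row j) (k : Fin M) :
    testPS r (rawOf J, (k.val, tripOf J k)) = true ↔
      row k ∈ Submodule.span (ZMod 2) (row '' {j : Fin M | j < k}) := by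
  unfold testPS
  rw [inSpan_iff, rawOf_eq]
  simp only
  rw [hrow, vecL_image_take J r row hrow]
  rfl

/-- **Correctness of the prefix-span solver**, generic in the row shape. -/
theorem solPS_correct (J : LocalMap 3 N M) (r : ℕ × ℕ × ℕ → List ℕ) (row : Fin M → Vec N)
    (hrow : ∀ j, vecL N (r (tripOf J j)) = row j)
    (hex : ∃ k : Fin M, row k ∈ Submodule.span (ZMod 2) (row '' {j | j < k}))
    (hsound : ∀ k : Fin M, row k ∈ Submodule.span (ZMod 2) (row '' {j | j < k}) →
      ∀ y : Fin M → Bool, (∀ j < k, y j = false) → y k = true → y ∉ J.range) :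
    (fun p : Fin M => (solPS r (rawOf J)).getD p.val false) ∉ J.range := by
  obtain ⟨k, hk⟩ := hex
  have hx₀ : testPS r (rawOf J, (k.val, tripOf J k)) = true := (testPS_iff J r row hrow k).2 hk
  cases h : (enumT (rawOf J)).find? (fun x => testPS r (rawOf J, x)) with
  | none => exact absurd hx₀ (by have := List.find?_eq_none.1 h _ (mem_enumT J k); simpa using this)
  | some x =>
    have hx := List.find?_some h
    obtain ⟨p, rfl⟩ := (mem_enumT_iff J).1 (List.mem_of_find?_eq_some h)
    have hp := (testPS_iff J r row hrow p).1 hx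
    have hsol : solPS r (rawOf J) = indic M [p.val] := by unfold solPS; rw [h]; rfl
    refine hsound p hp _ (fun j hj => ?_) ?_
    · show (solPS r (rawOf J)).getD j.val false = false
      rw [hsol, indic_at]
      have : j.val ≠ p.val := Nat.ne_of_lt hj
      simp [this]
    · show (solPS r (rawOf J)).getD p.val false = true
      rw [hsol, indic_at]; simp

/-- The prefix-span solver is polynomial time. -/
theorem codeFP_solPS {r : ℕ × ℕ × ℕ → List ℕ} (hr : CodeFP tripE (rawE natE) r) :
    CodeFP prE (rawE bitE) (solPS r) := by
  have hN : CodeFP (pairE prE etE) unE (fun q => q.1.1) := (fst _ _).fst'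
  have hrows : CodeFP (pairE prE etE) (rawE (rawE natE)) (fun q => (q.1.2.2.take q.2.1).map r) :=
    (map₀ hr).comp ((rawTakeNat tripE).comp ((snd _ _).fst'.pair (fst _ _).snd'.snd'))
  have hv : CodeFP (pairE prE etE) (rawE natE) (fun q => r q.2.2) := hr.comp (snd _ _).snd'
  have ht : CodeFP (pairE prE etE) bitE (testPS r) :=
    (codeFP_inSpan.comp (hN.pair (hrows.pair hv))).congr fun _ => rfl
  have hro : CodeFP etE (rawE natE) (fun x : ETrip => [x.1]) := (rawSingleton natE).comp (fst _ _)
  exact (codeFP_searchOutCtx codeFP_enumT ht hro).congr fun pr => by unfold solPS; rfl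

/-- Solver, class `3`. -/
def sol3 : PRaw → List Bool := solPS r3
/-- Solver, class `7`. -/
def sol7 : PRaw → List Bool := solPS r7

/-- Correctness, class `3`. -/
theorem sol3_correct (J : LocalMap 3 N M) (hP : J.IsPure (rep 3)) (hM : N < M) :
    (fun p : Fin M => (sol3 (rawOf J)).getD p.val false) ∉ J.range :=
  solPS_correct J r3 (row3 J) (vecL_r3 J) (cert3_exists J hM) fun k hk _ hlt hyk => cert3_sound hP k hk hlt hyk

/-- Correctness, class `7`. -/
theorem sol7_correct (J : LocalMap 3 N M) (hP : J.IsPure (rep 7)) (hM : N < M) :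
    (fun p : Fin M => (sol7 (rawOf J)).getD p.val false) ∉ J.range :=
  solPS_correct J r7 (row7 J) (vecL_r7 J) (cert7_exists J hM) fun k hk _ hlt hyk => cert7_sound hP k hk hlt hyk

/-- Polynomial time, class `3`. -/
theorem codeFP_sol3 : CodeFP prE (rawE bitE) sol3 := codeFP_solPS codeFP_r3
/-- Polynomial time, class `7`. -/
theorem codeFP_sol7 : CodeFP prE (rawE bitE) sol7 := codeFP_solPS codeFP_r7

/-! ## Class 8: all-equal outputs -/

/-- The pair-rows of all outputs other than (the index of) `e`. -/
def rows8 (pr : PRaw) (e : ℕ) : List (List ℕ) :=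
  (((enumT pr).filter fun f => !decide (f.1 = e)).map fun f => [r3 f.2, r9 f.2]).flatten

/-- Test, class `8`: both pair-rows of `e` depend on the other outputs' pair-rows. -/
def test8 (q : PRaw × ETrip) : Bool :=
  inSpan q.1.1 (rows8 q.1 q.2.1) (r3 q.2.2) && inSpan q.1.1 (rows8 q.1 q.2.1) (r9 q.2.2)

/-- Solver, class `8`: everything on except the dependent output. -/
def sol8 (pr : PRaw) : List Bool :=
  cosearchOut pr.2.1 (((enumT pr).find? fun x => test8 (pr, x)).map fun x => [x.1])

/-- Output length, class `8`. -/
@[simp] theorem length_sol8 (pr : PRaw) : (sol8 pr).length = pr.2.1 := by unfold sol8; simp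

/-- The pair-rows of the other outputs, as vectors. -/
theorem vecL_image_rows8 (J : LocalMap 3 N M) (e : Fin M) :
    vecL N '' {x | x ∈ rows8 (rawOf J) e.val} = {v | ∃ f, f ≠ e ∧ ∃ i', v = row8 J f i'} := by
  ext v
  simp only [rows8, Set.mem_image, Set.mem_setOf_eq, List.mem_flatten, List.mem_map, List.mem_filter,
    Bool.not_eq_true', decide_eq_false_iff_not]
  constructor
  · rintro ⟨x, ⟨l, ⟨f, ⟨hf, hfe⟩, rfl⟩, hx⟩, rfl⟩
    obtain ⟨p, rfl⟩ := (mem_enumT_iff J).1 hf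
    have hpe : p ≠ e := fun h => hfe (by rw [h])
    simp only [List.mem_cons, List.not_mem_nil, or_false] at hx
    rcases hx with rfl | rfl
    · exact ⟨p, hpe, 0, by rw [vecL_r3]; simp [row8, row3]⟩
    · exact ⟨p, hpe, 1, by rw [vecL_r9]; simp [row8, row9]⟩
  · rintro ⟨f, hfe, i', rfl⟩
    refine ⟨if i' = 0 then r3 (tripOf J f) else r9 (tripOf J f),
      ⟨[r3 (tripOf J f), r9 (tripOf J f)], ⟨(f.val, tripOf J f), ⟨mem_enumT J f, fun h => hfe (Fin.ext h)⟩, rfl⟩, ?_⟩, ?_⟩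
    · by_cases h : i' = 0 <;> simp [h]
    · by_cases h : i' = 0
      · subst h; simp [row8, vecL_r3, row3]
      · have : i' = 1 := by fin_cases i' <;> simp_all
        subst this; simp [row8, vecL_r9, row9]

/-- Reading the class-`8` test on a genuine instance. -/
theorem test8_iff (J : LocalMap 3 N M) (e : Fin M) :
    test8 (rawOf J, (e.val, tripOf J e)) = true ↔
      ∀ i, row8 J e i ∈ Submodule.span (ZMod 2) {v | ∃ f, f ≠ e ∧ ∃ i', v = row8 J f i'} := by
  unfold test8
  rw [Bool.and_eq_true, inSpan_iff, inSpan_iff, rawOf_N, vecL_image_rows8, vecL_r3, vecL_r9]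
  constructor
  · rintro ⟨h0, h1⟩ i
    fin_cases i
    · simpa [row8, row3] using h0
    · simpa [row8, row9] using h1
  · intro h
    exact ⟨by simpa [row8, row3] using h 0, by simpa [row8, row9] using h 1⟩

/-- Correctness, class `8`. -/
theorem sol8_correct (J : LocalMap 3 N M) (hP : J.IsPure (rep 8)) (hM : N < M) :
    (fun p : Fin M => (sol8 (rawOf J)).getD p.val false) ∉ J.range := by
  obtain ⟨e, he⟩ := cert8_exists J hM
  have he' : ∀ i, row8 J e i ∈ Submodule.span (ZMod 2) {v | ∃ f, f ≠ e ∧ ∃ i', v = row8 J f i'} := by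
    intro i
    refine Submodule.span_mono (fun v hv => ?_) (he i)
    obtain ⟨f, hf, i', hv⟩ := hv
    exact ⟨f, Fin.ne_of_lt hf, i', hv⟩
  have hx₀ := (test8_iff J e).2 he'
  cases h : (enumT (rawOf J)).find? (fun x => test8 (rawOf J, x)) with
  | none => exact absurd hx₀ (by have := List.find?_eq_none.1 h _ (mem_enumT J e); simpa using this)
  | some x =>
    have hx := List.find?_some h
    obtain ⟨p, rfl⟩ := (mem_enumT_iff J).1 (List.mem_of_find?_eq_some h)
    have hp := (test8_iff J p).1 hx
    have hsol : sol8 (rawOf J) = coindic M [p.val] := by unfold sol8; rw [h]; rfl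
    refine cert8_sound hP p hp (fun f hf => ?_) ?_
    · show (sol8 (rawOf J)).getD f.val false = true
      rw [hsol, coindic_at]
      have : f.val ≠ p.val := fun h => hf (Fin.ext h)
      simp [this]
    · show (sol8 (rawOf J)).getD p.val false = false
      rw [hsol, coindic_at]; simp

/-- Polynomial time, class `8`. -/
theorem codeFP_sol8 : CodeFP prE (rawE bitE) sol8 := by
  have hrows : CodeFP (pairE prE natE) (rawE (rawE natE)) (fun q => rows8 q.1 q.2) := by
    have hf : CodeFP (pairE natE etE) bitE (fun t => !decide (t.2.1 = t.1)) :=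
      (codeFP_eqTest (snd _ _).fst' (fst _ _)).not
    have hflt : CodeFP (pairE prE natE) (rawE etE) (fun q => (enumT q.1).filter fun f => !decide (f.1 = q.2)) :=
      ((filter hf).comp ((snd _ _).pair (codeFP_enumT.comp (fst _ _)))).congr fun _ => rfl
    have hitem : CodeFP etE (rawE (rawE natE)) (fun f : ETrip => [r3 f.2, r9 f.2]) :=
      (rawCons (rawE natE)).comp ((codeFP_r3.comp (snd _ _)).pair
        ((rawSingleton (rawE natE)).comp (codeFP_r9.comp (snd _ _))))
    exact ((CodeFP.flatten (rawE natE)).comp ((map₀ hitem).comp hflt)).congr fun _ => rfl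
  have hN : CodeFP (pairE prE etE) unE (fun q => q.1.1) := (fst _ _).fst'
  have hR : CodeFP (pairE prE etE) (rawE (rawE natE)) (fun q => rows8 q.1 q.2.1) :=
    hrows.comp ((fst _ _).pair (snd _ _).fst')
  have ht : CodeFP (pairE prE etE) bitE test8 :=
    ((codeFP_inSpan.comp (hN.pair (hR.pair (codeFP_r3.comp (snd _ _).snd')))).and
      (codeFP_inSpan.comp (hN.pair (hR.pair (codeFP_r9.comp (snd _ _).snd'))))).congr fun _ => rfl
  have hro : CodeFP etE (rawE natE) (fun x : ETrip => [x.1]) := (rawSingleton natE).comp (fst _ _)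
  exact (codeFP_cosearchOutCtx codeFP_enumT ht hro).congr fun pr => by unfold sol8; rfl

end Summit.PneNP.PneNP.Theorems.Nc03Reduction
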